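import Summits.AnomalousDissipation.AnomalousDissipation.Theses.Correlation
import Literature.Analysis.FluidPDE.TorusClassicalLerayHopfProofs
import Literature.Analysis.FluidPDE.StokesTorusProofs
import Literature.Analysis.FluidPDE.LongTimeAveragePeriodic
import Literature.Analysis.FunctionSpaces.TorusFourierModes
import Literature.Analysis.FunctionSpaces.TorusEnstrophyOrthogonality
import Literature.Analysis.FunctionSpaces.TorusSpaceTime

/-!
# Refutation of `Correlation.EnergyUnboundedNeg` (stmt-AnomalousDissipation-0204): Galilean drift

`EnergyUnboundedNeg` (route `AnomalousDissipation/Correlation`, crux rank 5, "= ¬ BoundedEnergyFamily")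
claims: for EVERY smooth divergence-free mean-zero force `f ≠ 0` on `T³`, every sequence of viscosities
`ν_j → 0` and EVERY family of global Leray–Hopf solutions `u_j` (data `u₀ j` arbitrary in `L²`), the
long-time mean energies `meanEnergy (u j) = limsup_T T⁻¹∫₀ᵀ‖u_j‖₂²` are unbounded in `j`.
The data are not asked to have zero mean (neither does `Literature.Turb.ZerothLaw`), and the statement
is false by a Galilean boost of Kolmogorov's laminar state [refuted-misstated]: for the shear force
`f = sin(2π x₀) e₁` (a Stokes eigenfield, `Torus.stokesMode (1,0,0) e₁ false`) and unit drift across the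
force pattern, the STEADY field `u_ν = e₀ + Re(z_ν e^{2πi x₀}) e₁`, `z_ν = -i/(4π²ν + 2πi)` (Doppler-detuned
linear response, `|z_ν| ≤ 1/(2π)` uniformly in `ν`) is an exact classical solution of NS_ν with zero
pressure: `(u·∇)u = ∂₀u` (pure sweeping), `∂₀u_ν - νΔu_ν = f` mode by mode. Classical ⟹ global
Leray–Hopf (`Torus.IsClassicalNSSolutionOn.isGlobalLerayHopf`, proved in tree), and
`meanEnergy ≤ ∫‖u_ν‖² ≤ 4` for all `ν`; with `ν_j = 1/(j+1)` this is a bounded-energy family, so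
`BoundedEnergyFamily` (stmt-0203) holds as typed and its negation 0204 is false. (Two-dimensional twin in
tree: `Literature.Barriers.AnomalousDissipation.GravestModeLaminarAttractorSwept`; FMRT 2001 Ch. II
(2.6)–(2.9) for the Galilean reduction.) The witness carries no turbulence: its dissipation is
`ν‖∇u_ν‖² = 2π²ν|z_ν|² → 0`.
REPAIR (planner): C′ = `EnergyUnboundedNeg` with the extra hypothesis `(∀ j, Torus.HasZeroMean (u₀ j))`
(zero total momentum; equivalently `∀ j t, HasZeroMean (u j t)` by momentum conservation) — the witness
misses C′ (its momentum is `e₀ ≠ 0`), and C′ is genuinely open ("turbulent saturation", Doering–Foias 2002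
§3); dually add the same clause to `BoundedEnergyFamily`/`BoundedEnergyEquality` (stmt-0203/0202), which are
otherwise provable by this laminar witness and carry no content.
All auxiliary facts are `have`s inside the single theorem (refuter files carry negations only).
Route review 2026-08-15, refuter-rreview1-AnomalousDissipation-Correlati-bfb9d062-0.
The refuted decl was then replaced in the route by `EnergyUnboundedNegZM` (zero-momentum clause,
stmt-AnomalousDissipation-14642; route repair rev 7, 2026-08-16T04:39:49Z); it is re-created privately
below, so the theorem's (append-only) statement is unchanged and nothing depends on the retired
route name.
-/

/-- PRIVATE re-creation (route namespace stays free; a refuted statement, NOT a cited fact) of the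
route decl `…Theses.Correlation.EnergyUnboundedNeg`, stmt-AnomalousDissipation-0204, which the planner
REPLACED by `EnergyUnboundedNegZM` (adds `∀ j, HasZeroMean (u₀ j)`) after the refutation below, so the
name left `Theses/Correlation.lean` (full-build breakage 2026-08-16, `Unknown identifier`): the item's
recorded signature verbatim, so that the append-only refuting theorem keeps elaborating. -/
private def Summit.AnomalousDissipation.AnomalousDissipation.Theses.Correlation.EnergyUnboundedNeg :
    Prop :=
  ∀ f : UnitAddTorus (Fin 3) → EuclideanSpace ℝ (Fin 3),
    Literature.Analysis.FunctionSpaces.Torus.IsSmooth f →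
    Literature.Analysis.FunctionSpaces.Torus.IsDivFree f →
    Literature.Analysis.FunctionSpaces.Torus.HasZeroMean f → f ≠ 0 →
    ∀ (ν : ℕ → ℝ) (u₀ : ℕ → UnitAddTorus (Fin 3) → EuclideanSpace ℝ (Fin 3))
      (u : ℕ → ℝ → UnitAddTorus (Fin 3) → EuclideanSpace ℝ (Fin 3)),
      (∀ j, 0 < ν j) → Filter.Tendsto ν Filter.atTop (nhds 0) →
      (∀ j, Literature.Analysis.FluidPDE.Torus.IsGlobalLerayHopf (ν j) (fun _ => f) (u₀ j) (u j)) →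
      ¬ ∃ E : ℝ, ∀ j, Literature.Analysis.FluidPDE.meanEnergy (u j) ≤ E

namespace Summit.AnomalousDissipation.AnomalousDissipation.Theorems

open scoped BigOperators Topology ENNReal InnerProductSpace
open Filter Set MeasureTheory UnitAddTorus
open Literature.Analysis Literature.Analysis.FunctionSpaces Literature.Analysis.FluidPDE

/-- Refutes `Correlation.EnergyUnboundedNeg` (stmt-AnomalousDissipation-0204) [refuted-misstated]:
for the shear force `f = sin(2πx₀)e₁` the Galilean-boosted laminar states
`u_ν = e₀ + Re(z_ν e^{2πix₀})e₁`, `z_ν = -i/(4π²ν+2πi)`, are steady classical (hence global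
Leray–Hopf) solutions of NS_ν with `∫‖u_ν‖² ≤ 4` for every `ν`, so along `ν_j = 1/(j+1)` the mean
energies are bounded; witness = unit drift of the datum across the force pattern; repaired
statement adds `∀ j, HasZeroMean (u₀ j)`, which the witness misses. [folklore] -/
theorem CorrelationEnergyUnboundedNeg_refuted :
    ¬ Summit.AnomalousDissipation.AnomalousDissipation.Theses.Correlation.EnergyUnboundedNeg := by
  intro hNeg
  /- (0) the frequency `k₀ = (1,0,0)` and the unit vectors `e₀`, `e₁` -/
  obtain ⟨k₀, hk₀⟩ : ∃ k₀ : Fin 3 → ℤ, k₀ = Pi.single 0 1 := ⟨_, rfl⟩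
  obtain ⟨e₀, he₀⟩ : ∃ e₀ : EuclideanSpace ℝ (Fin 3), e₀ = EuclideanSpace.single 0 1 := ⟨_, rfl⟩
  obtain ⟨e₁, he₁⟩ : ∃ e₁ : EuclideanSpace ℝ (Fin 3), e₁ = EuclideanSpace.single 1 1 := ⟨_, rfl⟩
  have hk₀0 : k₀ 0 = 1 := by simp [hk₀]
  have hk₀1 : k₀ 1 = 0 := by simp [hk₀]
  have hk₀2 : k₀ 2 = 0 := by simp [hk₀]
  have hk₀ne : k₀ ≠ 0 := fun h0 => by simp [h0] at hk₀0
  have he₀0 : e₀ 0 = 1 := by simp [he₀]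
  have he₁0 : e₁ 0 = 0 := by simp [he₁]
  have he₁1 : e₁ 1 = 1 := by simp [he₁]
  have he₁ne : e₁ ≠ 0 := fun h0 => by simp [h0] at he₁1
  have hnorm_e₀ : ‖e₀‖ = 1 := by simp [he₀]
  have hnorm_e₁ : ‖e₁‖ = 1 := by simp [he₁]
  /- (1) the force `f = sin(2π x₀) e₁`, a first-shell Stokes eigenfield -/
  set f : UnitAddTorus (Fin 3) → EuclideanSpace ℝ (Fin 3) := ⇑(Torus.stokesMode k₀ e₁ false)
    with hf_def
  have hfs : Torus.IsSmooth f := Torus.isSmooth_stokesMode k₀ e₁ false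
  have hka : ⟪Torus.latticeVec k₀, e₁⟫_ℝ = 0 := by
    rw [he₁, EuclideanSpace.inner_single_right]
    simp [Torus.latticeVec_apply, hk₀1]
  have hfd : Torus.IsDivFree f := Torus.isDivFree_stokesMode hka false
  have hfm : Torus.HasZeroMean f := Torus.hasZeroMean_stokesMode hk₀ne e₁ false
  have hfne : f ≠ 0 := by
    intro hf0
    apply Torus.stokesModeL2_ne_zero hk₀ne he₁ne false
    have hcm : Torus.stokesMode k₀ e₁ false = 0 := ContinuousMap.ext fun x => congrFun hf0 x
    change ContinuousMap.toLp (E := EuclideanSpace ℝ (Fin 3)) 2 volume ℝ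
      (Torus.stokesMode k₀ e₁ false) = 0
    rw [hcm, map_zero]
  have hf_poly : f = Torus.realTrigPoly {k₀}
      (fun _ => (-Complex.I) • EuclideanSpace.complexify e₁) := by
    rw [hf_def, Torus.stokesMode_eq_realTrigPoly]
    simp
  /- real scalars pass through the real part as complex scalars -/
  have hR : ∀ (r : ℝ) (v : EuclideanSpace ℂ (Fin 3)),
      r • EuclideanSpace.realPart v = EuclideanSpace.realPart ((r : ℂ) • v) := by
    intro r v
    ext i
    simp [EuclideanSpace.realPart_apply]
  /- (2) for every viscosity: an explicit steady classical solution with `∫‖u‖² ≤ 4` -/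
  have key : ∀ ν : ℝ, ∃ u : UnitAddTorus (Fin 3) → EuclideanSpace ℝ (Fin 3),
      Torus.IsClassicalNSSolutionOn univ ν (fun _ => f) (fun _ => u) (fun _ _ => (0 : ℝ)) ∧
        ∫ x, ‖u x‖ ^ 2 ≤ 4 := by
    intro ν
    -- the response amplitude `z = -i/(4π²ν + 2πi)`; Doppler detuning gives `‖z‖ ≤ 1`
    obtain ⟨w, hw⟩ : ∃ w : ℂ, w = ((4 * Real.pi ^ 2 * ν : ℝ) : ℂ) + 2 * Real.pi * Complex.I :=
      ⟨_, rfl⟩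
    have hw_im : w.im = 2 * Real.pi := by
      rw [hw, Complex.add_im, Complex.ofReal_im, zero_add]
      simp
    have hw_norm : 1 ≤ ‖w‖ := by
      have h := Complex.abs_im_le_norm w
      rw [hw_im, abs_of_pos (by positivity)] at h
      linarith [Real.pi_gt_three]
    have hw_ne : w ≠ 0 := by
      intro h0
      rw [h0, norm_zero] at hw_norm
      linarith
    obtain ⟨z, hz⟩ : ∃ z : ℂ, z = -Complex.I / w := ⟨_, rfl⟩
    have hzw : z * w = -Complex.I := by rw [hz, div_mul_cancel₀ _ hw_ne]
    have hz_norm : ‖z‖ ≤ 1 := by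
      rw [hz, norm_div, norm_neg, Complex.norm_I]
      exact div_le_one_of_le₀ hw_norm (norm_nonneg _)
    -- coefficients `c 0 = e₀` (drift), `c k₀ = z e₁` (response); modes `S = {0, k₀}`
    obtain ⟨c, hc⟩ : ∃ c : (Fin 3 → ℤ) → EuclideanSpace ℂ (Fin 3),
        c = fun k => if k = 0 then EuclideanSpace.complexify e₀
          else z • EuclideanSpace.complexify e₁ := ⟨_, rfl⟩
    have hc0 : c 0 = EuclideanSpace.complexify e₀ := by simp [hc]
    have hck : c k₀ = z • EuclideanSpace.complexify e₁ := by simp [hc, hk₀ne]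
    obtain ⟨S, hS⟩ : ∃ S : Finset (Fin 3 → ℤ), S = {0, k₀} := ⟨_, rfl⟩
    have h0S : (0 : Fin 3 → ℤ) ∉ ({k₀} : Finset (Fin 3 → ℤ)) := by simpa using hk₀ne.symm
    have hmemS : ∀ k ∈ S, k = 0 ∨ k = k₀ := fun k hk => by simpa [hS] using hk
    set u : UnitAddTorus (Fin 3) → EuclideanSpace ℝ (Fin 3) := Torus.realTrigPoly S c with hu_def
    have hus : Torus.IsSmooth u := Torus.isSmooth_realTrigPoly S c
    have hu1 : Torus.IsContDiff 1 u := hus.isContDiff (by simp)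
    -- incompressibility: the coefficients are transversal
    have htrans : Torus.IsTransversal S c := by
      intro k hk
      rcases hmemS k hk with rfl | rfl
      · simp
      · rw [hck]
        simp [Fin.sum_univ_three, hk₀0, hk₀1, hk₀2, he₁0]
    have hud : Torus.IsDivFree u := Torus.isDivFree_realTrigPoly htrans
    -- the first coordinate of `u` is the drift `1`
    have hu0 : ∀ x, u x 0 = 1 := by
      intro x
      rw [hu_def, Torus.realTrigPoly_apply_coord, Torus.trigPoly_apply_coord, hS,
        Finset.sum_insert h0S, Finset.sum_singleton, hc0, hck]
      simp [he₀0, he₁0, mFourier_zero]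
    -- partial derivatives in the cross-stream directions vanish
    have hdi : ∀ i : Fin 3, (∀ k ∈ S, k i = 0) → ∀ x, Torus.partialDeriv i u x = 0 := by
      intro i hi x
      have hcoef : ∀ k ∈ S, (2 * ↑Real.pi * Complex.I * ↑(k i)) • c k =
          (0 : (Fin 3 → ℤ) → EuclideanSpace ℂ (Fin 3)) k := by
        intro k hk
        simp [hi k hk]
      rw [hu_def, Torus.partialDeriv_realTrigPoly, Torus.realTrigPoly_congr hcoef,
        Torus.realTrigPoly_zero]
      rfl
    have hS1 : ∀ k ∈ S, k 1 = 0 := fun k hk => by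
      rcases hmemS k hk with rfl | rfl <;> simp [hk₀1]
    have hS2 : ∀ k ∈ S, k 2 = 0 := fun k hk => by
      rcases hmemS k hk with rfl | rfl <;> simp [hk₀2]
    -- the convective term is pure sweeping: `(u·∇)u = ∂₀ u`
    have hconv : ∀ x, Torus.convect u u x =
        Torus.realTrigPoly S (fun k => (2 * ↑Real.pi * Complex.I * ↑(k 0)) • c k) x := by
      intro x
      rw [Torus.convect_eq_sum_smul_partialDeriv hu1 x, Fin.sum_univ_three, hdi 1 hS1 x,
        hdi 2 hS2 x, smul_zero, smul_zero, add_zero, add_zero, hu0 x, one_smul, hu_def,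
        Torus.partialDeriv_realTrigPoly]
    -- the momentum equation `(u·∇)u = νΔu - ∇0 + f`, mode by mode
    have hfreq0 : Torus.freqNormSq (0 : Fin 3 → ℤ) = 0 := by simp [Torus.freqNormSq]
    have hfreqk : Torus.freqNormSq k₀ = 1 := by
      simp [Torus.freqNormSq, Fin.sum_univ_three, hk₀0, hk₀1, hk₀2]
    have hmom : ∀ x, Torus.convect u u x =
        ν • Torus.laplacian u x - Torus.gradient (fun _ : UnitAddTorus (Fin 3) => (0 : ℝ)) x
          + f x := by
      intro x
      have hgrad : Torus.gradient (fun _ : UnitAddTorus (Fin 3) => (0 : ℝ)) x = 0 := by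
        unfold Torus.gradient Torus.liftAt
        exact gradient_fun_const 0 0
      rw [hgrad, sub_zero, hconv x, hu_def, Torus.laplacian_realTrigPoly, hf_poly,
        Torus.realTrigPoly_apply_eq_sum, Torus.realTrigPoly_apply_eq_sum,
        Torus.realTrigPoly_apply_eq_sum, hS, Finset.sum_insert h0S, Finset.sum_insert h0S,
        Finset.sum_singleton, Finset.sum_singleton, Finset.sum_singleton, hck, hfreq0, hfreqk,
        hk₀0]
      simp only [Pi.zero_apply, Int.cast_zero, mul_zero, zero_smul, smul_zero, map_zero,
        zero_add, Complex.ofReal_zero, neg_zero, Int.cast_one, mul_one]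
      rw [hR, ← map_add]
      congr 1
      simp only [smul_smul, smul_neg]
      rw [← neg_smul, ← add_smul]
      congr 1
      have hzw' : z * (((4 * Real.pi ^ 2 * ν : ℝ) : ℂ) + 2 * Real.pi * Complex.I) =
          -Complex.I := by
        rw [← hw]
        exact hzw
      push_cast at hzw' ⊢
      linear_combination (mFourier k₀ x : ℂ) * hzw'
    have hNS : Torus.IsClassicalNSSolutionOn univ ν (fun _ => f) (fun _ => u)
        (fun _ _ => (0 : ℝ)) :=
      { smooth_velocity := Torus.isSmoothSpaceTimeOn_const hus univ
        smooth_pressure := Torus.isSmoothSpaceTimeOn_const (Torus.isSmooth_const (0 : ℝ)) univ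
        momentum := fun t _ x => by
          have ht : Torus.timeDerivWithin univ (fun _ : ℝ => u) t x = 0 := by
            simp [Torus.timeDerivWithin]
          rw [ht, zero_add]
          exact hmom x
        divFree := fun _ _ => hud }
    -- energy: `‖u(x)‖ ≤ ‖e₀‖ + ‖z e₁‖ ≤ 2` pointwise, the torus has volume one
    have hux : ∀ x, ‖u x‖ ≤ 2 := by
      intro x
      refine (Torus.norm_realTrigPoly_apply_le S c x).trans ?_
      rw [hS, Finset.sum_insert h0S, Finset.sum_singleton, hc0, hck, norm_smul,
        EuclideanSpace.norm_complexify, EuclideanSpace.norm_complexify, hnorm_e₀, hnorm_e₁]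
      linarith
    have hint : ∫ x, ‖u x‖ ^ 2 ≤ 4 := by
      have h4 : ∫ x, ‖u x‖ ^ 2 ≤ ∫ _x : UnitAddTorus (Fin 3), (4 : ℝ) := by
        refine integral_mono ((Torus.memLp_realTrigPoly S c 2).integrable_norm_pow two_ne_zero)
          (integrable_const _) fun x => ?_
        have hx := hux x
        have h0 := norm_nonneg (u x)
        nlinarith
      simpa using h4
    exact ⟨u, hNS, hint⟩
  /- (3) the bounded-energy vanishing-viscosity family `ν_j = 1/(j+1)`, `u_j(t) = u_{ν_j}` -/
  choose u hu using key
  set ν : ℕ → ℝ := fun j => 1 / ((j : ℝ) + 1) with hν_def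
  have hνpos : ∀ j, 0 < ν j := fun j => by
    rw [hν_def]
    positivity
  have hν0 : Tendsto ν atTop (𝓝 0) := tendsto_one_div_add_atTop_nhds_zero_nat
  refine hNeg f hfs hfd hfm hfne ν (fun j => u (ν j)) (fun j _ => u (ν j)) hνpos hν0
    (fun j => (hu (ν j)).1.isGlobalLerayHopf) ⟨4, fun j => ?_⟩
  show meanEnergy (fun _ : ℝ => u (ν j)) ≤ 4
  have hper : Function.Periodic (fun _ : ℝ => u (ν j)) 1 := fun _ => rfl
  rw [meanEnergy_eq_of_periodic hper one_pos]
  simp only [intervalIntegral.integral_const, sub_zero, inv_one, one_mul, smul_eq_mul]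
  exact (hu (ν j)).2

end Summit.AnomalousDissipation.AnomalousDissipation.Theorems
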